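import Summits.CriticalPhenomena.PercolationContinuityZ3.Theorems.SoloInformedCubeFace
import Summits.CriticalPhenomena.PercolationContinuityZ3.Theorems.SoloInformedAnnulusProduct
import HarnessLib

/-!
# Summable sheets: the box-shape faces in summable form, and the rate at which sheets vanish in a jump world

Solo seat `solo-CriticalPhenomena-informed`, session 19 (sharpest-statement §7b.3 (d6), *Remark
(summable form)*).  New mathematics of this programme (no published source); it combines three
kernel files of this seat:

* `SoloInformedSlabBoxFace`: if every one of the `2d` slab-boxes of scale `n` is thin-blocked with
  probability `≥ b` then `P_p(Λ(n) ↔ ∂ⁱⁿΛ(3n) in Λ(3n)) ≤ 1 - b^{2d}` (`real_boxCrossing_three_mul_le`),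
  all slab-boxes having the same crossing probability (`real_thinCrossing_eq`);
* `SoloInformedCubeFace`: the same for the near-cubes `[u,(r+1)u] × [0,(r+2)u]^{d-1}` of a grid,
  with exponent `K = #(Fin d × Λ(2r+2))` (`real_boxCrossing_le_of_slabCrossing`, `real_slabCrossing_eq`);
* `SoloInformedAnnulusProduct`: along every strictly increasing scale sequence,
  `∑_i (1 - P_p(Λ(s i + 1) ↔ ∂ⁱⁿΛ(s (i+1)) in Λ(s (i+1)))) ≤ -log θ(p)` whenever `θ(p) > 0`
  (`sum_boxCrossing_deficit_le_neg_log_theta`, independence of disjoint annuli).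

Writing `b_F(p,n) := 1 - P_p(thinCrossing n k₀ 1)` for the blocking probability of ONE `1:3`
slab-box and `b_Q(p,u) := 1 - P_p(slabCrossing u r k₀ 0)` for that of ONE `r:(r+2)` brick, we get,
at EVERY `p` with `θ(p) > 0` and in every dimension:

* `sum_pow_thinBlocking_le_neg_log_theta`: `∑_{i<j} b_F(p, n i)^{2d} ≤ -log θ(p)` along every scale
  sequence with `3·n i + 1 ≤ n (i+1)`; hence (`summable_pow_thinBlocking_of_theta_pos`) the powers
  `b_F(p, n i)^{2d}` are summable — the quantitative rate at which closed separating sheets of the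
  slab-boxes must disappear in a jump world;
* `sum_pow_slabBlocking_le_neg_log_theta`, `summable_pow_slabBlocking_of_theta_pos`: the same for
  the bricks, exponent `K`, along mesh sequences with `2(r+1)·u i + 1 ≤ (r+1)·u (i+1)`;

and, by contraposition at `p = p_c`, the SUMMABLE FORMS of the faces (F) and (Q):

* `percolationContinuity_of_not_summable_pow_thinBlocking`: if `∑_i b_F(p_c, n i)^{2d} = ∞` along one
  such sequence then `θ(p_c) = 0` — so in `d = 3` it suffices that `b_F(p_c, n_i) ≥ i^{-1/6}` along
  `n_{i+1} ≥ 3 n_i + 1`, instead of `≥ c`;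
* `percolationContinuity_of_not_summable_pow_slabBlocking`: the brick version; and the `ℤ³` instances.
-/


noncomputable section

namespace Summit.CriticalPhenomena.PercolationContinuityZ3.Theorems

open MeasureTheory ProbabilityTheory Filter Topology
open Literature.Probability.Percolation Literature.Probability.LatticeModels
open Literature.Probability.Percolation.CerfDembinVanishing
open scoped ENNReal

namespace SurfaceTension

variable {d : ℕ}

/-! ## Slab-boxes (aspect `1:3`) -/

/-- One term: along a scale sequence with `3·n i + 1 ≤ n (i+1)` (and `n i ≥ 1`), the `2d`-th power of
the blocking probability of one slab-box at scale `n i` is at most the crossing deficit of the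
annulus between `Λ(n i)` and `Λ(n (i+1) - 1)`. -/
theorem pow_thinBlocking_le_deficit (p : unitInterval) (k₀ : Fin d) {n : ℕ → ℕ}
    (hn : ∀ i, 1 ≤ n i) (hgrow : ∀ i, 3 * n i + 1 ≤ n (i + 1)) (i : ℕ) :
    (1 - (bondPercolation (zdGraph d) p).real (thinCrossing (n i) k₀ 1)) ^ (2 * d) ≤
      1 - (bondPercolation (zdGraph d) p).real (boxCrossing d (n i) (n (i + 1) - 1)) := by
  set μ := bondPercolation (zdGraph d) p with hμ
  set b : ℝ := 1 - μ.real (thinCrossing (n i) k₀ 1) with hb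
  have hb0 : 0 ≤ b := by
    have : μ.real (thinCrossing (n i) k₀ 1) ≤ 1 := measureReal_le_one
    simp only [hb]; linarith
  have h3 : μ.real (boxCrossing d (n i) (3 * n i)) ≤ 1 - b ^ (2 * d) := by
    refine real_boxCrossing_three_mul_le p (hn i) hb0 fun i' ε => ?_
    rw [real_thinCrossing_eq p (n i) i' k₀ ε]
  have hmono : μ.real (boxCrossing d (n i) (n (i + 1) - 1)) ≤ μ.real (boxCrossing d (n i) (3 * n i)) := by
    refine measureReal_mono fun ω hω => ?_
    have h1 : n i ≤ 3 * n i := by have := hn i; omega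
    have h2 : 3 * n i ≤ n (i + 1) - 1 := by have := hgrow i; omega
    exact boxCrossing_anti h1 h2 hω
  linarith

/-- **Rate at which sheets vanish in a jump world (slab-boxes).** If `θ(p) > 0` then along every
scale sequence with `n i ≥ 1` and `3·n i + 1 ≤ n (i+1)`, for every `j`,
`∑_{i<j} (1 - P_p(thinCrossing (n i) k₀ 1))^{2d} ≤ -log θ(p)`. -/
theorem sum_pow_thinBlocking_le_neg_log_theta (p : unitInterval) (k₀ : Fin d) {n : ℕ → ℕ}
    (hn : ∀ i, 1 ≤ n i) (hgrow : ∀ i, 3 * n i + 1 ≤ n (i + 1))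
    (hθ : 0 < theta (zdGraph d) 0 p) (j : ℕ) :
    ∑ i ∈ Finset.range j,
        (1 - (bondPercolation (zdGraph d) p).real (thinCrossing (n i) k₀ 1)) ^ (2 * d) ≤
      -Real.log (theta (zdGraph d) 0 p) := by
  -- the scale sequence of the annuli: `s i = n i - 1`
  set s : ℕ → ℕ := fun i => n i - 1 with hs_def
  have hs : StrictMono s := by
    refine strictMono_nat_of_lt_succ fun i => ?_
    have h1 := hn i; have h2 := hgrow i; have h3 := hn (i + 1)
    simp only [hs_def]; omega
  have hgap : ∀ i, s i + 1 ≤ s (i + 1) := by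
    intro i; have h1 := hn i; have h2 := hgrow i; simp only [hs_def]; omega
  have key := sum_boxCrossing_deficit_le_neg_log_theta (d := d) p hs hgap hθ j
  refine le_trans (Finset.sum_le_sum fun i _ => ?_) key
  have hsi : s i + 1 = n i := by have := hn i; simp only [hs_def]; omega
  rw [hsi]
  exact pow_thinBlocking_le_deficit p k₀ hn hgrow i

/-- Summability form: if `θ(p) > 0` then `i ↦ (1 - P_p(thinCrossing (n i) k₀ 1))^{2d}` is summable with
sum `≤ -log θ(p)`, along every scale sequence as above. -/
theorem summable_pow_thinBlocking_of_theta_pos (p : unitInterval) (k₀ : Fin d) {n : ℕ → ℕ}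
    (hn : ∀ i, 1 ≤ n i) (hgrow : ∀ i, 3 * n i + 1 ≤ n (i + 1))
    (hθ : 0 < theta (zdGraph d) 0 p) :
    Summable (fun i => (1 - (bondPercolation (zdGraph d) p).real (thinCrossing (n i) k₀ 1)) ^ (2 * d)) ∧
      ∑' i, (1 - (bondPercolation (zdGraph d) p).real (thinCrossing (n i) k₀ 1)) ^ (2 * d) ≤
        -Real.log (theta (zdGraph d) 0 p) := by
  have h0 : ∀ i, 0 ≤ (1 - (bondPercolation (zdGraph d) p).real (thinCrossing (n i) k₀ 1)) ^ (2 * d) := by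
    intro i
    have : (bondPercolation (zdGraph d) p).real (thinCrossing (n i) k₀ 1) ≤ 1 := measureReal_le_one
    exact pow_nonneg (by linarith) _
  exact ⟨summable_of_sum_range_le h0 (sum_pow_thinBlocking_le_neg_log_theta p k₀ hn hgrow hθ),
    Real.tsum_le_of_sum_range_le h0 (sum_pow_thinBlocking_le_neg_log_theta p k₀ hn hgrow hθ)⟩

/-- **Face (F) in summable form.** If along one scale sequence with `n i ≥ 1`, `3·n i + 1 ≤ n (i+1)`
the powers `(1 - P_{p_c}(thinCrossing (n i) k₀ 1))^{2d}` are NOT summable, then `θ(p_c) = 0`. -/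
theorem percolationContinuity_of_not_summable_pow_thinBlocking (k₀ : Fin d) {n : ℕ → ℕ}
    (hn : ∀ i, 1 ≤ n i) (hgrow : ∀ i, 3 * n i + 1 ≤ n (i + 1))
    (h : ¬ Summable (fun i =>
      (1 - (bondPercolation (zdGraph d) (criticalProbI d)).real (thinCrossing (n i) k₀ 1)) ^ (2 * d))) :
    PercolationContinuity d := by
  by_contra hne
  have hθ : 0 < theta (zdGraph d) 0 (criticalProbI d) :=
    lt_of_le_of_ne measureReal_nonneg (Ne.symm hne)
  exact h (summable_pow_thinBlocking_of_theta_pos _ k₀ hn hgrow hθ).1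

/-- The `ℤ³` case of the summable slab-box face. -/
theorem percolationContinuityZ3_of_not_summable_pow_thinBlocking {n : ℕ → ℕ}
    (hn : ∀ i, 1 ≤ n i) (hgrow : ∀ i, 3 * n i + 1 ≤ n (i + 1))
    (h : ¬ Summable (fun i =>
      (1 - (bondPercolation (zdGraph 3) (criticalProbI 3)).real (thinCrossing (n i) (0 : Fin 3) 1)) ^ 6)) :
    PercolationContinuityZ3 :=
  percolationContinuity_of_not_summable_pow_thinBlocking (0 : Fin 3) hn hgrow h

/-! ## Near-cubes (aspect `r:(r+2)`) -/

/-- One term for the bricks: along a mesh sequence with `2(r+1)·u i + 1 ≤ (r+1)·u (i+1)` the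
`K`-th power (`K = #(Fin d × Λ(2r+2))`) of the blocking probability of one brick of mesh `u i` is at
most the crossing deficit of the annulus between `Λ((r+1)·u i)` and `Λ((r+1)·u (i+1) - 1)`. -/
theorem pow_slabBlocking_le_deficit (p : unitInterval) (k₀ : Fin d) {r : ℕ} (hr : 1 ≤ r)
    {u : ℕ → ℕ} (hu : ∀ i, 1 ≤ u i) (hgrow : ∀ i, 2 * ((r + 1) * u i) + 1 ≤ (r + 1) * u (i + 1))
    (i : ℕ) :
    (1 - (bondPercolation (zdGraph d) p).real (slabCrossing (u i) r k₀ 0)) ^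
        ((Finset.univ : Finset (Fin d)) ×ˢ box d (2 * r + 2)).card ≤
      1 - (bondPercolation (zdGraph d) p).real
        (boxCrossing d ((r + 1) * u i) ((r + 1) * u (i + 1) - 1)) := by
  set μ := bondPercolation (zdGraph d) p with hμ
  set b : ℝ := 1 - μ.real (slabCrossing (u i) r k₀ 0) with hb
  have hb0 : 0 ≤ b := by
    have : μ.real (slabCrossing (u i) r k₀ 0) ≤ 1 := measureReal_le_one
    simp only [hb]; linarith
  have h2 : μ.real (boxCrossing d ((r + 1) * u i) (2 * ((r + 1) * u i))) ≤
      1 - b ^ ((Finset.univ : Finset (Fin d)) ×ˢ box d (2 * r + 2)).card := by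
    refine real_boxCrossing_le_of_slabCrossing p (hu i) hr hb0 fun k g _ => ?_
    rw [real_slabCrossing_eq p (u i) r k k₀ g]
  have hmono : μ.real (boxCrossing d ((r + 1) * u i) ((r + 1) * u (i + 1) - 1)) ≤
      μ.real (boxCrossing d ((r + 1) * u i) (2 * ((r + 1) * u i))) := by
    refine measureReal_mono fun ω hω => ?_
    have h1 : (r + 1) * u i ≤ 2 * ((r + 1) * u i) := by omega
    have h3 : 2 * ((r + 1) * u i) ≤ (r + 1) * u (i + 1) - 1 := by have := hgrow i; omega
    exact boxCrossing_anti h1 h3 hω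
  linarith

/-- **Rate at which sheets vanish in a jump world (near-cubes).** If `θ(p) > 0` then along every
mesh sequence with `u i ≥ 1`, `2(r+1)·u i + 1 ≤ (r+1)·u (i+1)`, for every `j`,
`∑_{i<j} (1 - P_p(slabCrossing (u i) r k₀ 0))^K ≤ -log θ(p)`. -/
theorem sum_pow_slabBlocking_le_neg_log_theta (p : unitInterval) (k₀ : Fin d) {r : ℕ} (hr : 1 ≤ r)
    {u : ℕ → ℕ} (hu : ∀ i, 1 ≤ u i) (hgrow : ∀ i, 2 * ((r + 1) * u i) + 1 ≤ (r + 1) * u (i + 1))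
    (hθ : 0 < theta (zdGraph d) 0 p) (j : ℕ) :
    ∑ i ∈ Finset.range j,
        (1 - (bondPercolation (zdGraph d) p).real (slabCrossing (u i) r k₀ 0)) ^
          ((Finset.univ : Finset (Fin d)) ×ˢ box d (2 * r + 2)).card ≤
      -Real.log (theta (zdGraph d) 0 p) := by
  set s : ℕ → ℕ := fun i => (r + 1) * u i - 1 with hs_def
  have hpos : ∀ i, 1 ≤ (r + 1) * u i := fun i => by
    have := hu i; nlinarith
  have hs : StrictMono s := by
    refine strictMono_nat_of_lt_succ fun i => ?_
    have h1 := hpos i; have h2 := hgrow i; have h3 := hpos (i + 1)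
    simp only [hs_def]; omega
  have hgap : ∀ i, s i + 1 ≤ s (i + 1) := by
    intro i; have h1 := hpos i; have h2 := hgrow i; simp only [hs_def]; omega
  have key := sum_boxCrossing_deficit_le_neg_log_theta (d := d) p hs hgap hθ j
  refine le_trans (Finset.sum_le_sum fun i _ => ?_) key
  have hsi : s i + 1 = (r + 1) * u i := by have := hpos i; simp only [hs_def]; omega
  rw [hsi]
  exact pow_slabBlocking_le_deficit p k₀ hr hu hgrow i

/-- Summability form for the bricks. -/
theorem summable_pow_slabBlocking_of_theta_pos (p : unitInterval) (k₀ : Fin d) {r : ℕ} (hr : 1 ≤ r)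
    {u : ℕ → ℕ} (hu : ∀ i, 1 ≤ u i) (hgrow : ∀ i, 2 * ((r + 1) * u i) + 1 ≤ (r + 1) * u (i + 1))
    (hθ : 0 < theta (zdGraph d) 0 p) :
    Summable (fun i => (1 - (bondPercolation (zdGraph d) p).real (slabCrossing (u i) r k₀ 0)) ^
        ((Finset.univ : Finset (Fin d)) ×ˢ box d (2 * r + 2)).card) ∧
      ∑' i, (1 - (bondPercolation (zdGraph d) p).real (slabCrossing (u i) r k₀ 0)) ^
          ((Finset.univ : Finset (Fin d)) ×ˢ box d (2 * r + 2)).card ≤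
        -Real.log (theta (zdGraph d) 0 p) := by
  have h0 : ∀ i, 0 ≤ (1 - (bondPercolation (zdGraph d) p).real (slabCrossing (u i) r k₀ 0)) ^
      ((Finset.univ : Finset (Fin d)) ×ˢ box d (2 * r + 2)).card := by
    intro i
    have : (bondPercolation (zdGraph d) p).real (slabCrossing (u i) r k₀ 0) ≤ 1 := measureReal_le_one
    exact pow_nonneg (by linarith) _
  exact ⟨summable_of_sum_range_le h0 (sum_pow_slabBlocking_le_neg_log_theta p k₀ hr hu hgrow hθ),
    Real.tsum_le_of_sum_range_le h0 (sum_pow_slabBlocking_le_neg_log_theta p k₀ hr hu hgrow hθ)⟩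

/-- **Face (Q) in summable form.** If along one mesh sequence with `u i ≥ 1`,
`2(r+1)·u i + 1 ≤ (r+1)·u (i+1)` the powers `(1 - P_{p_c}(slabCrossing (u i) r k₀ 0))^K` are NOT
summable, then `θ(p_c) = 0`. -/
theorem percolationContinuity_of_not_summable_pow_slabBlocking (k₀ : Fin d) {r : ℕ} (hr : 1 ≤ r)
    {u : ℕ → ℕ} (hu : ∀ i, 1 ≤ u i) (hgrow : ∀ i, 2 * ((r + 1) * u i) + 1 ≤ (r + 1) * u (i + 1))
    (h : ¬ Summable (fun i =>
      (1 - (bondPercolation (zdGraph d) (criticalProbI d)).real (slabCrossing (u i) r k₀ 0)) ^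
        ((Finset.univ : Finset (Fin d)) ×ˢ box d (2 * r + 2)).card)) :
    PercolationContinuity d := by
  by_contra hne
  have hθ : 0 < theta (zdGraph d) 0 (criticalProbI d) :=
    lt_of_le_of_ne measureReal_nonneg (Ne.symm hne)
  exact h (summable_pow_slabBlocking_of_theta_pos _ k₀ hr hu hgrow hθ).1

/-- The `ℤ³` case of the summable cube face. -/
theorem percolationContinuityZ3_of_not_summable_pow_slabBlocking {r : ℕ} (hr : 1 ≤ r)
    {u : ℕ → ℕ} (hu : ∀ i, 1 ≤ u i) (hgrow : ∀ i, 2 * ((r + 1) * u i) + 1 ≤ (r + 1) * u (i + 1))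
    (h : ¬ Summable (fun i =>
      (1 - (bondPercolation (zdGraph 3) (criticalProbI 3)).real (slabCrossing (u i) r (0 : Fin 3) 0)) ^
        ((Finset.univ : Finset (Fin 3)) ×ˢ box 3 (2 * r + 2)).card)) :
    PercolationContinuityZ3 :=
  percolationContinuity_of_not_summable_pow_slabBlocking (0 : Fin 3) hr hu hgrow h

end SurfaceTension

end Summit.CriticalPhenomena.PercolationContinuityZ3.Theorems

end
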